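import Summits.RiemannHypothesis.RiemannHypothesis.Theorems.TiltedLandingLaw421R3QuadW

/-! # TiltedLandingLaw421R3FormsQ
SUPPORT module for crux `TiltedLandingLaw421` (stmt-RiemannHypothesis-24774), `--supports … --as helper` only: proves no stub, no crux; fully proved (no `sorry`).
W-08 ROUND-3b (director (CA334) option (Q) / (CA335) rule: BAND-quadratic (Markov) tracking window `(max (|u.re − x₀| − R/2) 0)² + j·(u.im)² ≤ j·Hs²` (aperture R/2; level 0 = `StCol' 0` verbatim) as conjunct 4 of `RhW08.QuadW.StColQ'`, replacing the linear column clause `|u.re − x₀| ≤ R/2 + j·(s/4)` of `StCol'` (C6 ADD-86 frame A / ADD-92 frame C; (CA333) HOLD); node `RhW08.SealSwapQ.law421T_of_alphaFreeQ`, stub texts `RhW08.SealSwapQ.RestSuccBotQ`/`RestRateBotQ`, composition `law421T_of_succ_rateQ`, INIT♯^Q from INIT♯ by `restInitBotQ_of_restInitBot` (typing-robust, rev d), NO α stub; tracked-class typing (iv) BAND MEMBERSHIP `StTrkDQ := StColQ'` (C1 WORDS-60/60b/61 part-1 image `splitQ1-R3QuadW-band-W08-C1-rh-idea-5-g24.lean`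 0a4973de over C4 rev d parts 2/3; `band_step'`/`band_of_quad'`/`band_of_hull'` proved: BAND ⊇ Q, BAND ⊇ HULL); part-1 typing keyed by director g21 on the bus per the (CA335) rule (see the tenure CERT); parts 2/3 byte-identical under every part-1 typing)
cut by tenure rh-tenure-earlyapp-1 g7 from the single rc-0 base `monolithK29-band-W08-C1-rh-idea-5-g24.lean` sha256 d9d5cc26bdbc420bb637c77656e7eaed80199db59ff477a17aa0c34a6c080e5c (C1 g24 WORDS-61 (band) over C4 g26 §K.29 rev d base monolithK29-band-W08-C1-rh-idea-5-g24.lean d9d5cc26bdbc420b): decl blocks byte-verbatim, base order, dependency closure of the roots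
{PTrkSQ, SigmaMinTrkSQ, ZRestTrkSHFRQ, CanonRestTrkSQ, zRestTrkSHFR_iff_canonQ, delta_gt_of_chargedQ, LitRestTrkSQ, tollSum_canon_eq_litQ, canonRestTrkS_iff_litQ, RateRestTrkSQ, tollSum_lit_eq_rateQ, litRestTrkS_iff_rateQ, zRestTrkSHFR_iff_rateQ} minus every declaration already LANDED in the W-08 tree chain (#986 R2StSwap · #988 R2Ready · #991 R2TrkD · #994 R2NodeD · #998 R2NodeDR · #999 R2CoreP · #1000 R2FlatM · #1007 R3Forms · #1008 R3Bot).
K = kernel-checked lemmas about MODEL sockets (combs / polynomials), not ζ/Ξ. Typed ≠ proved; RH is not proved; 24774 OPEN. -/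

namespace RhW08.SealSwapQ

open Complex
open RhIdea6.G17.W07C7 RhIdea6.G17.W07C7.Rev6 RhIdea6.G18.W07C8.Law421BirthS RhIdea6.G19.W07C11.Seam
open RhIdea6.G20.W07C12.Frac RhIdea6.G20.W07C12.StColP RhW07.C12.FieldSplit RhIdea6.G21.W07C13.TentMax
open RhW07.C14.TwoSided RhW07.C14.Classes RhW07.C14.Lineage RhW07.C14.Booking
open RhW07.C13.Heredity RhIdea6.G22.W07C15pre.Injection RhW07.E3.Cell
open RhW07.E3.Lit
open RhW08.Round1 RhW08.StSwap RhW08.Round2 RhW08.QuadW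
open RhW08.SealSwap (PBot)

section Family

/-- §K.16b the round-2R CHARGE co-predicate with SEAL `Pσ`: sealed OR the tracked successor already sits `s/4` lower. (`PTrkSQ PSealC4` is `PTrkD`.) -/
def PTrkSQ (Pσ : StatePred) : StatePred := POr Pσ (SuccOf (1 / 4) StTrkDQ)

/-- §K.16b the minimal settler of the family. (`SigmaMinTrkSQ PSealC4` is `SigmaMinTrkDR′`.) -/
noncomputable def SigmaMinTrkSQ (Pσ : StatePred) : LevelMeter := sigmaMin (PTrkSQ Pσ) StTrkDQ ReadyR2 EmptyTrkDQ (tentMeterTrkD (3 / 2))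

/-- ★★ §K.16b **β(Pσ)** — signed tolls, stop Ready′, height purse, booked-root meter, seal `Pσ`. (`ZRestTrkSHFRQ PSealC4` IS the keyed stub `ZRestTrkDHFR′`.) -/
def ZRestTrkSHFRQ (Pσ : StatePred) : Prop :=
  RestBudgetGF (1 / 4) (PTrkSQ Pσ) StTrkDQ ReadyR2 EmptyTrkDQ (SigmaMinTrkSQ Pσ) (heightBudget (tentMeterTrkD (3 / 2)) StTrkDQ) (tentMeterTrkD (3 / 2))
end Family

section Forms

/-- §K.16c the canonical form of β(Pσ) (generic `CanonRestGM` at the family's literals). -/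
def CanonRestTrkSQ (Pσ : StatePred) : Prop := CanonRestGM (1 / 4) (PTrkSQ Pσ) StTrkDQ ReadyR2 EmptyTrkDQ (tentMeterTrkD (3 / 2))

/-- ★★★ §K.16c (K) `β(Pσ) ↔ CanonRestTrkSQ Pσ` (toll witness eliminated). -/
theorem zRestTrkSHFR_iff_canonQ (Pσ : StatePred) : ZRestTrkSHFRQ Pσ ↔ CanonRestTrkSQ Pσ :=
  restBudgetGF_min_iff_canon (by norm_num) levelFinite_stTrkDQ upperStates_stTrkDQ _ _

/-- ★ (K) THE `s/4` FLOOR AT CHARGED LEVELS: a charged level (some lowest non-ready state is unsealed AND has no `s/4`-lower tracked successor) whose successor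
level is inhabited satisfies `−s/4 < lowH (j+1) − lowH j` — so the `max (−μs) ·` of the canonical toll is inactive for this family. -/
theorem delta_gt_of_chargedQ {Pσ : StatePred} {η : ℝ} {f : ℂ → ℂ} {x₀ s hmax R Hs : ℝ} {B : ℕ} (hE : EngineHyps5 2 η f x₀ s hmax R Hs B) {j : ℕ}
    (hC : Charged (PTrkSQ Pσ) StTrkDQ ReadyR2 η f x₀ s hmax R Hs B j) (hne : ∃ u' : ℂ, StTrkDQ η f x₀ s hmax R Hs B (j + 1) u') :
    -(1 / 4 * s) < lowH StTrkDQ η f x₀ s hmax R Hs B (j + 1) - lowH StTrkDQ η f x₀ s hmax R Hs B j := by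
  obtain ⟨v, hv, -, hnP⟩ := hC
  obtain ⟨u', hu'⟩ := hne
  obtain ⟨w, hw, hweq⟩ := exists_isLowest_eq_lowH levelFinite_stTrkDQ upperStates_stTrkDQ hE hu'
  have h1 : ¬ (|w.im| + 1 / 4 * s ≤ |v.im|) := fun h => hnP (Or.inr ⟨w, hw.1, h⟩)
  have h2 : |v.im| = lowH StTrkDQ η f x₀ s hmax R Hs B j := abs_im_eq_lowH_of_isLowest upperStates_stTrkDQ hv
  rw [not_le] at h1
  linarith

open Classical in
/-- ★★ §K.16c the LITERAL (max-free) form of β(Pσ): (S♮) and, for every `k`,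
`chargeCount k + (T₀ᴿ − injected k)⁺ + Σ_{j<k}[Charged j] 4 (lowH (j+1) − lowH j)/s ≤ (Hs/s)² + B + 1 + 4 (hmax − rootHeight)/s`. -/
def LitRestTrkSQ (Pσ : StatePred) : Prop :=
  ∀ (η : ℝ) (f : ℂ → ℂ) (x₀ s hmax R Hs : ℝ) (B : ℕ), EngineHyps5 2 η f x₀ s hmax R Hs B →
    (∀ j : ℕ, Charged (PTrkSQ Pσ) StTrkDQ ReadyR2 η f x₀ s hmax R Hs B j → ∃ u' : ℂ, StTrkDQ η f x₀ s hmax R Hs B (j + 1) u') ∧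
    ∀ k : ℕ, chargeCount (PTrkSQ Pσ) StTrkDQ ReadyR2 η f x₀ s hmax R Hs B k
        + max (tentMeterTrkD (3 / 2) η f x₀ s hmax R Hs B 0 - injected (PTrkSQ Pσ) StTrkDQ ReadyR2 EmptyTrkDQ η f x₀ s hmax R Hs B k) 0
        + (∑ j ∈ Finset.range k, (if Charged (PTrkSQ Pσ) StTrkDQ ReadyR2 η f x₀ s hmax R Hs B j then
            4 * (lowH StTrkDQ η f x₀ s hmax R Hs B (j + 1) - lowH StTrkDQ η f x₀ s hmax R Hs B j) / s else 0))
      ≤ (Hs / s) ^ 2 + (B : ℝ) + 1 + 4 * (hmax - rootHeight StTrkDQ η f x₀ s hmax R Hs B) / s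

open Classical in
/-- (K) under (S♮) the canonical and the literal toll sums agree term by term. -/
theorem tollSum_canon_eq_litQ {Pσ : StatePred} {η : ℝ} {f : ℂ → ℂ} {x₀ s hmax R Hs : ℝ} {B : ℕ} (hE : EngineHyps5 2 η f x₀ s hmax R Hs B)
    (hSn : ∀ j : ℕ, Charged (PTrkSQ Pσ) StTrkDQ ReadyR2 η f x₀ s hmax R Hs B j → ∃ u' : ℂ, StTrkDQ η f x₀ s hmax R Hs B (j + 1) u') (k : ℕ) :
    (∑ j ∈ Finset.range k, (if Charged (PTrkSQ Pσ) StTrkDQ ReadyR2 η f x₀ s hmax R Hs B j then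
        max (-(1 / 4 * s)) (lowH StTrkDQ η f x₀ s hmax R Hs B (j + 1) - lowH StTrkDQ η f x₀ s hmax R Hs B j) / (1 / 4 * s) else 0))
      = ∑ j ∈ Finset.range k, (if Charged (PTrkSQ Pσ) StTrkDQ ReadyR2 η f x₀ s hmax R Hs B j then
        4 * (lowH StTrkDQ η f x₀ s hmax R Hs B (j + 1) - lowH StTrkDQ η f x₀ s hmax R Hs B j) / s else 0) := by
  have hs : 0 < s := hE.2.2.2.1
  refine Finset.sum_congr rfl fun j _ => ?_
  by_cases hC : Charged (PTrkSQ Pσ) StTrkDQ ReadyR2 η f x₀ s hmax R Hs B j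
  · rw [if_pos hC, if_pos hC, max_eq_right (le_of_lt (delta_gt_of_chargedQ hE hC (hSn j hC)))]
    rw [div_eq_div_iff (mul_pos (by norm_num : (0 : ℝ) < 1 / 4) hs).ne' hs.ne']
    ring
  · rw [if_neg hC, if_neg hC]

/-- ★★ §K.16c (K) canonical ⟺ literal. -/
theorem canonRestTrkS_iff_litQ (Pσ : StatePred) : CanonRestTrkSQ Pσ ↔ LitRestTrkSQ Pσ := by
  classical
  constructor
  · intro h η f x₀ s hmax R Hs B hE
    obtain ⟨hSn, hB⟩ := h η f x₀ s hmax R Hs B hE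
    refine ⟨hSn, fun k => ?_⟩
    rw [← tollSum_canon_eq_litQ hE hSn k]
    exact hB k
  · intro h η f x₀ s hmax R Hs B hE
    obtain ⟨hSn, hB⟩ := h η f x₀ s hmax R Hs B hE
    refine ⟨hSn, fun k => ?_⟩
    have h1 := hB k
    rw [← tollSum_canon_eq_litQ hE hSn k] at h1
    exact h1

open Classical in
/-- ★★★ §K.16c **THE RATE FORM** of β(Pσ) (telescoped; `rootHeight` cancels): (S♮) and, for every `k`,
`chargeCount k + (T₀ᴿ − injected k)⁺ + 4·lowH k/s + Σ_{j<k}[¬Charged j] 4 (lowH j − lowH (j+1))/s ≤ (Hs/s)² + B + 1 + 4·hmax/s`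
= «charged count + unspent root credit + current lowest tracked height/(s/4) + free-level drops/(s/4) ≤ LAW 421's depth purse». -/
def RateRestTrkSQ (Pσ : StatePred) : Prop :=
  ∀ (η : ℝ) (f : ℂ → ℂ) (x₀ s hmax R Hs : ℝ) (B : ℕ), EngineHyps5 2 η f x₀ s hmax R Hs B →
    (∀ j : ℕ, Charged (PTrkSQ Pσ) StTrkDQ ReadyR2 η f x₀ s hmax R Hs B j → ∃ u' : ℂ, StTrkDQ η f x₀ s hmax R Hs B (j + 1) u') ∧
    ∀ k : ℕ, chargeCount (PTrkSQ Pσ) StTrkDQ ReadyR2 η f x₀ s hmax R Hs B k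
        + max (tentMeterTrkD (3 / 2) η f x₀ s hmax R Hs B 0 - injected (PTrkSQ Pσ) StTrkDQ ReadyR2 EmptyTrkDQ η f x₀ s hmax R Hs B k) 0
        + 4 * lowH StTrkDQ η f x₀ s hmax R Hs B k / s
        + (∑ j ∈ Finset.range k, (if Charged (PTrkSQ Pσ) StTrkDQ ReadyR2 η f x₀ s hmax R Hs B j then 0 else
            4 * (lowH StTrkDQ η f x₀ s hmax R Hs B j - lowH StTrkDQ η f x₀ s hmax R Hs B (j + 1)) / s))
      ≤ (Hs / s) ^ 2 + (B : ℝ) + 1 + 4 * hmax / s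

open Classical in
/-- (K) telescoping: `Σ_{j<k}[Charged] 4Δ_j/s = 4·lowH k/s − 4·rootHeight/s + Σ_{j<k}[¬Charged] 4(lowH j − lowH (j+1))/s`. -/
theorem tollSum_lit_eq_rateQ (P : StatePred) (η : ℝ) (f : ℂ → ℂ) (x₀ s hmax R Hs : ℝ) (B k : ℕ) :
    (∑ j ∈ Finset.range k, (if Charged P StTrkDQ ReadyR2 η f x₀ s hmax R Hs B j then
        4 * (lowH StTrkDQ η f x₀ s hmax R Hs B (j + 1) - lowH StTrkDQ η f x₀ s hmax R Hs B j) / s else 0))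
      = 4 * lowH StTrkDQ η f x₀ s hmax R Hs B k / s - 4 * rootHeight StTrkDQ η f x₀ s hmax R Hs B / s
        + ∑ j ∈ Finset.range k, (if Charged P StTrkDQ ReadyR2 η f x₀ s hmax R Hs B j then 0 else
            4 * (lowH StTrkDQ η f x₀ s hmax R Hs B j - lowH StTrkDQ η f x₀ s hmax R Hs B (j + 1)) / s) := by
  have htel : (∑ j ∈ Finset.range k, (4 * lowH StTrkDQ η f x₀ s hmax R Hs B (j + 1) / s - 4 * lowH StTrkDQ η f x₀ s hmax R Hs B j / s))
      = 4 * lowH StTrkDQ η f x₀ s hmax R Hs B k / s - 4 * lowH StTrkDQ η f x₀ s hmax R Hs B 0 / s :=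
    Finset.sum_range_sub (fun j => 4 * lowH StTrkDQ η f x₀ s hmax R Hs B j / s) k
  rw [lowH_zero] at htel
  rw [← htel, ← Finset.sum_add_distrib]
  refine Finset.sum_congr rfl fun j _ => ?_
  by_cases hC : Charged P StTrkDQ ReadyR2 η f x₀ s hmax R Hs B j
  · rw [if_pos hC, if_pos hC]; ring
  · rw [if_neg hC, if_neg hC]; ring

/-- ★★ §K.16c (K) literal ⟺ rate. -/
theorem litRestTrkS_iff_rateQ (Pσ : StatePred) : LitRestTrkSQ Pσ ↔ RateRestTrkSQ Pσ := by
  classical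
  constructor
  · intro h η f x₀ s hmax R Hs B hE
    obtain ⟨hSn, hB⟩ := h η f x₀ s hmax R Hs B hE
    refine ⟨hSn, fun k => ?_⟩
    have h1 := hB k
    rw [tollSum_lit_eq_rateQ] at h1
    have h2 : 4 * (hmax - rootHeight StTrkDQ η f x₀ s hmax R Hs B) / s = 4 * hmax / s - 4 * rootHeight StTrkDQ η f x₀ s hmax R Hs B / s := by
      ring
    rw [h2] at h1
    linarith
  · intro h η f x₀ s hmax R Hs B hE
    obtain ⟨hSn, hB⟩ := h η f x₀ s hmax R Hs B hE
    refine ⟨hSn, fun k => ?_⟩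
    have h1 := hB k
    rw [tollSum_lit_eq_rateQ]
    have h2 : 4 * (hmax - rootHeight StTrkDQ η f x₀ s hmax R Hs B) / s = 4 * hmax / s - 4 * rootHeight StTrkDQ η f x₀ s hmax R Hs B / s := by
      ring
    rw [h2]
    linarith

/-- ★★★ §K.16c (K) β(Pσ) ⟺ RATE FORM. -/
theorem zRestTrkSHFR_iff_rateQ (Pσ : StatePred) : ZRestTrkSHFRQ Pσ ↔ RateRestTrkSQ Pσ :=
  ((zRestTrkSHFR_iff_canonQ Pσ).trans (canonRestTrkS_iff_litQ Pσ)).trans (litRestTrkS_iff_rateQ Pσ)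
end Forms

end RhW08.SealSwapQ
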